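import Mathlib
import Summits.NavierStokesRegularity.FluidComputer.AbcInertiaExactlyOneTight
import Summits.NavierStokesRegularity.FluidComputer.AbcClassIIEigenpairRow5002CClassical

/-!
# INERTIA-3L, CLASS II — «EXACTLY ONE», TIGHT FORM AT `R = 500`: the unique classical class-II eigenvalue with
# `Re z ≥ 6/25` lies within `Row5002C.rho = 5.4·10⁻⁹` of `Row5002C.lamRe = 0.2901820370561`
# (instab3 g9, cell `ns-blowup`, 2026-08-27)

HONEST FRAMING (human rulings D-0035/D-0074): **MODEL linear operator, computer-assisted; not NS.** Nothing
here is a statement about Navier–Stokes regularity or blow-up. Object: the linearisation of forced NS about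
`U = abcFlow 1 1 1` on the unit torus at viscosity `1/(2π·500)` (`R = 500`), symmetry class II. bears_on
LADDER-NS N1* T6 («leader order at R 500 — the LEADER FLIP between R 300 and R 500») / profile W3.
WHAT THIS IS NOT: not NS; no certificate re-run; no number or census word moves.

The `R = 500` sibling of `AbcInertiaExactlyOneTight` (R 300; cf. instab3 g8's `AbcInertiaExactlyOneR500`, which
draws existence from the X0 bracket `[0.2802, 0.3002]`): `a_le_row5002C` (`6/25 ≤ Row5002C.lamRe − ρ`) and
**`R500II_exactly_one_tight_i4`** — the T1 row `Row5002C` (class II, implementation C = profile-cert-3, complex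
orbit bases `wf`; hypotheses VERBATIM those of `AbcClassIIEigenpair.row5002C_classII_eigenpair_of_complex_bases`)
AND the INERTIA-3L class-II cell `(500, II, 6/25, 1; 36, 37)` of IMPLEMENTATION 2 (instab4 g8,
`inertia_cert_R500_cII_rL36_rH37.json`, kit j274818/j274542 — SINGLE implementation at R 500; (R1)(R2) in ANY
family `e` of real orthonormal orbit bases, `AbcInertiaBases`) ⇒ `σ_p(L_500|II) ∩ {Re ≥ 6/25} = {λ⋆}`, `λ⋆` REAL,
`|λ⋆ − 0.2901820370561| ≤ 5.4·10⁻⁹`. What is NOT kernel: the row's primary interval outputs and (R1)(R2),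
AUDIT-BASIS.

Mathlib + the two files named; no new definitions; std axioms. [folklore]
-/

noncomputable section

open scoped BigOperators ComplexConjugate InnerProductSpace Matrix
open Finset Matrix MeasureTheory UnitAddTorus

namespace Summit.NavierStokesRegularity.FluidComputer.AbcInertia

open Literature.Analysis.FunctionSpaces Literature.Analysis.FunctionSpaces.Torus
open Literature.Analysis.FunctionSpaces.EuclideanSpace
open Literature.Analysis.FluidPDE Literature.Analysis.FluidPDE.SteadyLattice
open Summit.NavierStokesRegularity.FluidComputer.AbcClassII
open Summit.NavierStokesRegularity.FluidComputer.CertificateAbcSpectrum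

/-- The class-II abscissa of record at `R = 500` lies left of the `Row5002C` enclosure:
`6/25 ≤ Row5002C.lamRe − Row5002C.rho` (`0.24 ≤ 0.29018… − 5.4·10⁻⁹`). -/
theorem a_le_row5002C : (6 / 25 : ℝ) ≤ ((Row5002C.lamRe : ℚ) : ℝ) - ((Row5002C.rho : ℚ) : ℝ) := by
  have h : (6 / 25 : ℚ) ≤ Row5002C.lamRe - Row5002C.rho := by norm_num [Row5002C.lamRe, Row5002C.rho]
  have h' : ((6 / 25 : ℚ) : ℝ) ≤ ((Row5002C.lamRe - Row5002C.rho : ℚ) : ℝ) := by exact_mod_cast h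
  push_cast at h'
  linarith

section Row

variable (wf : Idx → Fam)
variable (hws : ∀ i : Idx, ∀ k ∉ i.1.1, wf i k = 0)
variable (hwt : ∀ (i : Idx) (k : Fin 3 → ℤ), ∑ j : Fin 3, ((k j : ℤ) : ℂ) * wf i k j = 0)
variable (hwII : ∀ i : Idx, IsClassII (wf i))
variable (hwon : ∀ (O : Orbit) (a b : Fin (odim O)),
  ∑ k ∈ O.1, (inner ℂ (wf ⟨O, a⟩ k) (wf ⟨O, b⟩ k) : ℂ) = if a = b then 1 else 0)
variable (amc : Idx → Idx → ℂ)
variable (hamc : ∀ i j : Idx, amc i j =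
  ∑ k ∈ i.1.1, (inner ℂ (wf i k) (Torus.lerayCoeff k (crossForm 1 1 1 (wf j) k)) : ℂ))
variable (e : ∀ O : Orbit, OrthonormalBasis (Fin (odim O)) ℝ (realSpace O.1))
variable (bf : Idx → Fam)
variable (hbf : ∀ i : Idx, bf i = extend i.1.1 ((e i.1 i.2 : realSpace i.1.1) : EuclideanSpace ℂ (↥i.1.1 × Fin 3)))
variable (am : Idx → Idx → ℝ)
variable (ham : ∀ i j : Idx, am i j =
  (∑ k ∈ i.1.1, (inner ℂ (bf i k) (Torus.lerayCoeff k (crossForm 1 1 1 (bf j) k)) : ℂ)).re)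

include hws hwt hwII hwon hamc hbf ham in
/-- **R = 500, CLASS II: EXACTLY ONE, TIGHT — IMPLEMENTATION 2's INERTIA cell `(500, II, 6/25, 1; 36, 37)`.**
The T1 row `Row5002C` (complex orbit bases `wf`, hypotheses VERBATIM cert-3's) AND (R1)(R2) of the class-II cell in
the real orthonormal orbit bases `e` IMPLY: `λ⋆` with `|λ⋆ − Row5002C.lamRe| ≤ Row5002C.rho`, `Im λ⋆ = 0`,
`Row5002C.lamRe − Row5002C.rho ≤ Re λ⋆`, a classical CLASS-II eigenfunction at `λ⋆`, and EVERY classical class-II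
eigenpair `(z, u)` with `Re z ≥ 6/25` has `z = λ⋆`. MODEL; conditional on the two certifier audits and AUDIT-BASIS. -/
theorem R500II_exactly_one_tight_i4
    (vt : Idx → ℂ) (hvt0 : ∀ i, i ∉ cubeIdx 112 → vt i = 0)
    (hres : ∑ i ∈ cubeIdx 112 ∪ (cubeIdx 112).biUnion nbrIdx,
      ‖(if i ∈ cubeIdx 112 then ((((Row5002C.lamRe : ℚ) : ℝ) : ℂ) - ((-(onormSq i.1 / 500) : ℝ) : ℂ)) * vt i
          else 0) - ∑ j ∈ cubeIdx 112, amc i j * vt j‖ ^ 2 ≤ ((Row5002C.rnorm : ℚ) : ℝ) ^ 2)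
    (hntb : ∑ i ∈ cubeIdx 112 \ cubeIdx 28, ‖vt i‖ ^ 2 ≤
      (((1292560462104437 : ℚ) / 144115188075855872 : ℚ) : ℝ) ^ 2)
    (Binv : ((↥(cubeIdx 28) → ℂ) × ℂ) →ₗ[ℂ] ((↥(cubeIdx 28) → ℂ) × ℂ))
    (hBinv : ∀ (c : ↥(cubeIdx 28) → ℂ) (m : ℂ),
      Binv (fun i : ↥(cubeIdx 28) =>
          ((((Row5002C.lamRe : ℚ) : ℝ) : ℂ) - ((-(onormSq i.1.1 / 500) : ℝ) : ℂ)) * c i -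
          ∑ j : ↥(cubeIdx 28), amc i j * c j + m * vt i,
        ∑ i : ↥(cubeIdx 28), conj (vt i) * c i) = (c, m))
    (hαM : ∀ (c : ↥(cubeIdx 28) → ℂ) (g : ℂ),
      ∑ j : ↥(cubeIdx 28), ‖(Binv (c, g)).1 j‖ ^ 2 + ‖(Binv (c, g)).2‖ ^ 2 ≤
        ((Row5002C.alpha0 : ℚ) : ℝ) ^ 2 * (∑ i : ↥(cubeIdx 28), ‖c i‖ ^ 2 + ‖g‖ ^ 2))
    (hβBM : ∀ w : Idx → ℂ,
      ∑ j : ↥(cubeIdx 28), ‖(Binv (fun i : ↥(cubeIdx 28) => -∑ j ∈ nbrIdx i \ cubeIdx 28,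
          amc i j * w j, 0)).1 j‖ ^ 2 +
        ‖(Binv (fun i : ↥(cubeIdx 28) => -∑ j ∈ nbrIdx i \ cubeIdx 28,
          amc i j * w j, 0)).2‖ ^ 2 ≤
        ((Row5002C.betaB : ℚ) : ℝ) ^ 2 * ∑ j ∈ (cubeIdx 28).biUnion nbrIdx \ cubeIdx 28, ‖w j‖ ^ 2)
    (hβCM : ∀ (c : ↥(cubeIdx 28) → ℂ) (g : ℂ),
      ∑ i ∈ ((cubeIdx 28).biUnion nbrIdx ∪ cubeIdx 112) \ cubeIdx 28,
        ‖-∑ j : ↥(cubeIdx 28), amc i j * (Binv (c, g)).1 j +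
          (Binv (c, g)).2 * vt i‖ ^ 2 ≤
        ((Row5002C.betaC : ℚ) : ℝ) ^ 2 * (∑ i : ↥(cubeIdx 28), ‖c i‖ ^ 2 + ‖g‖ ^ 2))
    (hgBM : ∀ w : Idx → ℂ,
      ‖(Binv (fun i : ↥(cubeIdx 28) => ∑ j ∈ nbrIdx i \ cubeIdx 28,
          amc i j * w j, 0)).2‖ ^ 2 ≤
        (((2198037866660847 : ℚ) / 562949953421312 : ℚ) : ℝ) ^ 2 *
          ∑ j ∈ (cubeIdx 28).biUnion nbrIdx \ cubeIdx 28, ‖w j‖ ^ 2)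
    (hshellM : ∀ w : Idx → ℂ, (∀ i ∈ cubeIdx 28, w i = 0) →
      (((628200374963231 : ℚ) / 1125899906842624 : ℚ) : ℝ) * ∑ i ∈ cubeIdx (28 + 1) \ cubeIdx 28, ‖w i‖ ^ 2 ≤
        ∑ i ∈ cubeIdx (28 + 1) \ cubeIdx 28,
          ((((Row5002C.lamRe : ℚ) : ℝ) : ℂ).re - (-(onormSq i.1 / 500)) - Real.sqrt 2) * ‖w i‖ ^ 2 -
        RCLike.re (∑ i ∈ (cubeIdx 28).biUnion nbrIdx \ cubeIdx 28,
          conj (∑ j : ↥(cubeIdx 28), amc i j *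
            (Binv (fun i : ↥(cubeIdx 28) => ∑ j ∈ nbrIdx i \ cubeIdx 28,
              amc i j * w j, 0)).1 j) * w i))
    {HL HH HB : Finset Idx}
    (hHL : ∀ i : Idx, i ∈ HL ↔ onormSq i.1 ≤ (36 : ℝ) ^ 2)
    (hHH : ∀ i : Idx, i ∈ HH ↔ onormSq i.1 ≤ (37 : ℝ) ^ 2)
    (hHB : ∀ i : Idx, i ∈ HB ↔ (37 : ℝ) ^ 2 < onormSq i.1 ∧ onormSq i.1 ≤ ((37 : ℝ) + 1) ^ 2)
    (GH' Ah' : Matrix ↥HH ↥HH ℝ) (AHB' : Matrix ↥HH ↥HB ℝ) (ABH' : Matrix ↥HB ↥HH ℝ) (E : ↥HB → ℝ)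
    (V' : Matrix ↥HH (Fin 1) ℝ) (hGH' : GH'ᵀ = GH')
    (hAh' : Ah' = Matrix.of fun i j : ↥HH =>
      (if i = j then -(onormSq i.1.1 / (500 : ℝ)) - (6 / 25 : ℝ) else 0) + am i.1 j.1)
    (hAHB' : AHB' = Matrix.of fun (i : ↥HH) (l : ↥HB) => am i.1 l.1)
    (hABH' : ABH' = Matrix.of fun (l : ↥HB) (i : ↥HH) => am l.1 i.1)
    (hE : E = fun l : ↥HB => onormSq l.1.1 / (500 : ℝ) + (6 / 25 : ℝ) - Real.sqrt 2)
    (hR1' : ∀ x : ↥HH → ℝ, x ≠ 0 →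
      x ⬝ᵥ ((GH' * Ah' + Ah'ᵀ * GH' + (1 / 2 : ℝ) • ((GH' * AHB' + ABH'ᵀ) * Matrix.diagonal (fun l => (E l)⁻¹) *
        (GH' * AHB' + ABH'ᵀ)ᵀ)) *ᵥ x) < 0)
    (hR2' : ∀ x : ↥HH → ℝ, 0 ≤ x ⬝ᵥ ((GH' + V' * V'ᵀ) *ᵥ x)) :
    ∃ lam : ℂ, ‖lam - (((Row5002C.lamRe : ℚ) : ℝ) : ℂ)‖ ≤ ((Row5002C.rho : ℚ) : ℝ) ∧ lam.im = 0 ∧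
      ((Row5002C.lamRe : ℚ) : ℝ) - ((Row5002C.rho : ℚ) : ℝ) ≤ lam.re ∧
      (∃ u : UnitAddTorus (Fin 3) → EuclideanSpace ℂ (Fin 3),
        Torus.LinNSResolventRel (1 / (2 * Real.pi * 500)) (Torus.abcFlow 1 1 1) (2 * Real.pi * lam) u 0 ∧
          u ≠ 0 ∧ IsClassII (mFourierCoeff u)) ∧
      ∀ (z : ℂ) (u : UnitAddTorus (Fin 3) → EuclideanSpace ℂ (Fin 3)),
        Torus.LinNSResolventRel (1 / (2 * Real.pi * 500)) (Torus.abcFlow 1 1 1) (2 * Real.pi * z) u 0 → u ≠ 0 →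
          IsClassII (mFourierCoeff u) → (6 / 25 : ℝ) ≤ z.re → z = lam := by
  obtain ⟨lam, hclose, him, hrelo, -, hone, -, -⟩ :=
    AbcClassIIEigenpair.row5002C_classII_eigenpair_of_complex_bases wf hws hwt hwII hwon amc hamc vt hvt0 hres hntb
      Binv hBinv hαM hβBM hβCM hgBM hshellM
  exact exactly_one_of_row_of_cell (a := 6 / 25) a_le_row5002C
    (fun z hz u hu hu0 hII hre =>
      card_classII_eigenfunctions_le_of_inertia_certificate_of_bases e bf hbf am ham (R := 500) (a := 6 / 25)
        (rL := 36) (rH := 37) (m := 1) (by norm_num) (by norm_num) (by norm_num) hHL hHH hHB GH' Ah' AHB' ABH' E V'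
        hGH' hAh' hAHB' hABH' hE hR1' hR2' R3_500_37 z hz u hu hu0 hII hre)
    lam hclose him hrelo hone

end Row

end Summit.NavierStokesRegularity.FluidComputer.AbcInertia

end
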